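import Summits.ResolutionOfSingularities.ResolutionOfSingularities.Theorems.MarkedTransferCampaignW46TypedProcedure
import Literature.AlgebraicGeometry.Resolution.HironakaDirectrix
import Literature.AlgebraicGeometry.Resolution.Ridge
import Literature.AlgebraicGeometry.Resolution.HasseSchmidtDerivatives
import Literature.AlgebraicGeometry.Resolution.MarkedIdeals
import Mathlib.Algebra.MvPolynomial.PDeriv
import HarnessLib

/-!
# [OURS · L1 W4.6, rung (iv) «large characteristic», gen 2] STATEMENTS: the tangent-cone calculus (directrix / ridge /
# `τ`) of the typed procedure is characteristic-zero-like exactly for `p > b` — honest `C(n, d) = d`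
# — campaign s46 of cell res-hironaka (LADDER-RESOLUTION rung L, D-0089); host route MarkedTransfer,
# `--kind definition --supports stmt-ResolutionOfSingularities-16155 --as helper`; statement-only lane (res-L1-type-o1)

HONEST FRAMING. Everything below is OURS (campaign statements of slot W4.6 rung (iv), typed in the statement-only lane on
the hand-over of prover res-L1-s46-pv-7, HOME/STATUS 2026-08-27T02:26:44Z «PROPOSED OURS ITEM SIGNATURES for rung (iv)
gen 2 (C)–(G)»). NOTHING here is a statement of H. Hironaka's manuscript [Hironaka2017] and nothing of it is used or
asserted: every decl is a `def … : Prop` WITH PARAMETERS over the TREE's vocabulary (Cossart–Piltant's rendering of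
Hironaka's intrinsic directrix `invarianceSpace` / `hironakaTau` / `initialForms` / `hironakaTauAt`; Giraud's ridge
functor `ridge` and ridge ideal `ridgeIdeal`; the Hasse–Schmidt derivatives `hasseDeriv`; the stalk ideal `stalkIdeal`)
and the OURS vocabulary of the typed-procedure module (`AmbientDatum`, `IdealExponent`, `CampaignW46.Regime.charGT`; the
manuscript's typed candidates enter there only as DEFINITIONS). Each predicate is CLOSED BY NAME, at every value of its
parameters, by a kernel-checked theorem ALREADY LANDED by res-L1-s46-pv-7 (files `MarkedTransferCampaignW46TamePolar.lean`
p481074, `…TameRidgeFunctor.lean` p485759, `…TameRidgeIdeal.lean` p486683, `…TameRegime.lean` p483854); this file does NOT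
import those proof files (statements first; the closing file imports both; the typer scratch-checked on the farm that
the five one-line closers named below elaborate against these defs VERBATIM). AI review is weaker than expert review.
No `sorry`, no theorem.

## What these statements bank for rung (iv) (pv-7's analysis; RESCUE-SEED §1 row W4.6 (iv) «large `p` relative to
## dimension/degree: the explicit threshold `C` above which the typed procedure is char-0-like»)

The threshold question has a SHARP answer at the level of the TANGENT CONE (the first stage of every step of the typed
procedure: the directrix / ridge / `τ` of the order-`b` initial forms at a point): the derivative calculus that computes
Hironaka's invariance space, Giraud's ridge and `τ` from FIRST-ORDER data (partial derivatives / linear Hasse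
derivatives) is valid exactly in the TAME degrees `b < p`, and fails at `b = p` (the form `Y_0^p`). So the honest
constant is `C(n, d) = d` (the degree bound), independent of `n`. What happens at deeper levels (coefficient ideals,
the prior's V5 «wild data reappear at level 1 via `b!`») is NOT addressed by these statements.

* (C) `CampaignW46TameDirectrixFirstOrder p K d` — for `deg F < p`, `𝕎({F}) = ker (w ↦ Σ_i w_i ∂F/∂Y_i)`.
* (D) `CampaignW46TameRidgePolarKernel p K n` — for a form `F` of degree `b < p` and EVERY commutative `K`-algebra `k'`,
  the `k'`-points of the ridge of `(F)` are the zeros of the polar `Σ_i v_i ∂_i F`.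
* (E) `CampaignW46TameRidgeIdealLinear p K n` — for a form `F` of degree `b < p`, Giraud's ridge ideal of `(F)` is
  generated by the LINEAR Hasse derivatives `D^{(A)} F`, `|A| = b − 1` (BHM Lemma 3.6 / Algorithm 3.5 in the tame range).
* (F) `CampaignW46TameRegimeTauFirstOrder p K n` — at the TYPED level: in the regime `Regime.charGT n (fun _ b ↦ b)`
  («`E.b < p`», regime (iv) of the shared module with the honest threshold) `τ` is first-order at every point of every
  state: `τ_ξ(J_ξ, b) + dim ⋂_{G ∈ cl_b(J_ξ)} ker(polar of G) = d` for all `c_1, …, c_d ∈ 𝒪_{Z,ξ}`.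
* (G) `CampaignW46DirectrixNotFirstOrderAtCharDegree p K d` — SHARPNESS (honest-failure side): in characteristic `p`,
  `τ(Y_0^p) ≠ dim ⟨∂_i Y_0^p⟩` (`1 ≠ 0`) in `d + 1` variables.

## VACUITY / DEGENERATE-SLICE SELF-CHECK (typer's reading of OUR decls, not a verdict)

All five predicates are PROVED at every parameter value by the named closers, so none is vacuous-by-falsity; the check is
whether they are trivially true. (C)/(D)/(E) are implications with SATISFIABLE antecedents (`deg F < p`, resp. `F`
homogeneous of degree `b < p` — e.g. every linear or quadratic form for `p ≥ 3`) whose conclusions FAIL without the degree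
hypothesis — that is exactly (G) (and `TameRidgeFunctor`'s wild section: at `b = p` the ridge of `Y_0^p` has nilpotent
points outside the polar kernel's complement) — so they are not trivially true; at `d = 0` / `n = 0` (no variables) both
sides are the zero space / unit ideal and the slice is degenerate-true; the content sits at `d ≥ 1`, `2 ≤ deg F < p`.
(F): the antecedent `Regime.charGT n (fun _ b ↦ b) A E` is `E.b < p` (satisfiable by every exponent with `b < p`); the
hypothesis `CharP (𝒪_{Z,ξ}) p` is the typed rows' standing binder (derivable for a `K`-scheme, kept as proposed); the
conclusion is an honest identity `τ + dim(joint polar kernel) = d`, false in general at `b = p` by (G) read in the local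
ring. (G) is a closed inequality `1 ≠ 0`-shaped after computation, true at every `d`, `p` prime; its role is to certify
that the threshold in (C)–(F) cannot be lowered uniformly.

## Decls (namespace `…Theorems`; PREDICATES WITH PARAMETERS — a parameterless `def … : Prop` in a Theorems file is
## relocated by the gate as a «fact», lesson p482378)

`CampaignW46TameDirectrixFirstOrder p K d` · `CampaignW46TameRidgePolarKernel p K n` · `CampaignW46TameRidgeIdealLinear
p K n` · `CampaignW46TameRegimeTauFirstOrder p K n` · `CampaignW46DirectrixNotFirstOrderAtCharDegree p K d`, with the
closers (pv-7's, to be landed by a prover in a file importing this one and the proof files):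
`fun F hF => CampaignW46.TamePolar.invarianceSpace_singleton_eq_ker_polar_of_totalDegree_lt_char K p F hF` ·
`fun _ _ hF hb _ _ _ v => CampaignW46.TameRidgeFunctor.mem_ridge_span_singleton_iff_polar_eq_zero_of_lt_char p hF hb v` ·
`fun _ _ hF hb => CampaignW46.TameRidgeIdeal.ridgeIdeal_span_singleton_eq_span_linearHasse_of_lt_char p hF hb` ·
`fun A E hE ξ hp _ c => CampaignW46.TameRegime.hironakaTauAt_stalk_add_finrank_iInf_ker_polar A E hE ξ hp c` ·
`CampaignW46.TamePolar.hironakaTau_X_pow_char_ne_finrank_span_pderiv K p`.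

## References (context; nothing is cited as a premise)

* res-L1-s46-pv-7, HOME/STATUS 2026-08-27T02:26:44Z (hand-over (C)–(G), informal «[support] OURS L1 W4.6 (iv): the
  tangent-cone calculus (directrix / ridge / tau) of the typed procedure is characteristic-zero-like exactly for `p > b`
  (honest `C(n,d) = d`); RESCUE-SEED W4.6 (iv); NOT a statement of the manuscript»); the closers' files named above;
  `Theorems/MarkedTransferCampaignW46LargeCharStatement.lean` (gen 1 statements (A)/(B), p473772);
  plan/RESCUE-SEED.md §1 row W4.6 (iv) (index only).
* Tree vocabulary: `Literature/AlgebraicGeometry/Resolution/HironakaDirectrix.lean` [CossartPiltant2008, proof of Prop. 4.2],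
  `Ridge.lean` [Giraud1975, §1.5; BerthomieuHivertMourtada2010, Prop. 2.1], `HasseSchmidtDerivatives.lean`
  [VillamayorU2008ReesDiff, §2.6], `MarkedIdeals.lean`; barrier `Literature.Barriers.ResolutionOfSingularities.DirectrixSmallCharacteristic`
  (CJS Thm. 3.14 needs `char κ(x) = 0` or `≥ dim X/2 + 1` — the NEAR-POINT phenomenon, distinct from the calculus banked
  here; context only) [CossartJannsenSaito2020, Thm. 3.14, Rem. 18.29].
* J. Berthomieu, P. Hivert, H. Mourtada, *Computing Hironaka's invariants: ridge and directrix*, Contemp. Math. 521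
  (2010), Cor. 2.3, Lemma 3.6, Algorithm 3.5 — context for (D)/(E) [BerthomieuHivertMourtada2010].
-/

noncomputable section

set_option linter.dupNamespace false -- mandated namespace of this single-conjunct summit

open CategoryTheory AlgebraicGeometry TopologicalSpace

namespace Summit.ResolutionOfSingularities.ResolutionOfSingularities.Theorems

universe u

open scoped BigOperators

open Literature.AlgebraicGeometry.Resolution in
/-- [OURS · L1 W4.6 (iv)] replaces the role of «the directrix computation of the typed procedure is characteristic-zero-like
for `p > C(n, d)`» (RESCUE-SEED §1 row W4.6 (iv)) at the level of ONE tangent form — honest `C = deg F`; NOT a statement of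
the manuscript. **The tame directrix is first-order** (res-L1-s46-pv-7's proposed item (C) VERBATIM, STATUS
2026-08-27T02:26:44Z): in characteristic `p`, over the field `K`, in `d` variables, for every polynomial `F` of total
degree `< p`, Hironaka's invariance space of `{F}` (Cossart–Piltant: `𝕎({F}) = {w | F(Y + Tw) = F(Y)}`, tree
`invarianceSpace`) is the kernel of the polar map `w ↦ Σ_i w_i ∂F/∂Y_i`. CLOSED at every `(p, K, d)` by
`fun F hF => CampaignW46.TamePolar.invarianceSpace_singleton_eq_ker_polar_of_totalDegree_lt_char K p F hF` (p481074).
VACUITY: antecedent satisfiable (every `F` of degree `< p`); conclusion false without it at `deg F = p`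
(`CampaignW46DirectrixNotFirstOrderAtCharDegree`, `TamePolar.invarianceSpace_X_pow_char_ne_ker_polar`); degenerate-true
at `d = 0`. [folklore] -/
def CampaignW46TameDirectrixFirstOrder (p : ℕ) [Fact p.Prime] (K : Type u) [Field K] [CharP K p] (d : ℕ) : Prop :=
  ∀ F : MvPolynomial (Fin d) K, F.totalDegree < p →
    invarianceSpace K ({F} : Set (MvPolynomial (Fin d) K)) =
      LinearMap.ker (Fintype.linearCombination K fun i : Fin d => MvPolynomial.pderiv i F)

open Literature.AlgebraicGeometry.Resolution in
/-- [OURS · L1 W4.6 (iv)] replaces the role of «the ridge (Giraud's replacement of the directrix, CJS Rem. 18.29) of the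
typed procedure is characteristic-zero-like for `p > C(n, d)`» (RESCUE-SEED §1 row W4.6 (iv)) for ONE tangent form, as a
statement about the ridge FUNCTOR OF POINTS — honest `C = b`; NOT a statement of the manuscript. **Tame ridge = polar
kernel, on every `K`-algebra** (res-L1-s46-pv-7's proposed item (D) VERBATIM, STATUS 2026-08-27T02:26:44Z): in
characteristic `p`, over `K`, in `n` variables, for every form `F` of degree `b < p` and EVERY commutative `K`-algebra
`k'` (same universe as `K`), a point `v ∈ k'ⁿ` lies in the ridge of the principal ideal `(F)` (tree `ridge k' I`: the
translations preserving the cone ideal over `k'`) iff the polar `Σ_i v_i (∂_i F)` of the base-changed form vanishes.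
CLOSED at every `(p, K, n)` by `fun _ _ hF hb _ _ _ v =>
CampaignW46.TameRidgeFunctor.mem_ridge_span_singleton_iff_polar_eq_zero_of_lt_char p hF hb v` (p485759). VACUITY:
antecedent satisfiable; at `b = p` the equivalence fails (the ridge of `Y_0^p` is a genuine group scheme with nilpotent
points, `TameRidgeFunctor` § Wild); degenerate-true at `n = 0`. [folklore] -/
def CampaignW46TameRidgePolarKernel (p : ℕ) [Fact p.Prime] (K : Type u) [Field K] [CharP K p] (n : ℕ) : Prop :=
  ∀ (F : MvPolynomial (Fin n) K) (b : ℕ), F.IsHomogeneous b → b < p →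
    ∀ (k' : Type u) [CommRing k'] [Algebra K k'] (v : Fin n → k'),
      v ∈ ridge k' (Ideal.span {F}) ↔
        (∑ i, MvPolynomial.C (v i) * MvPolynomial.pderiv i (MvPolynomial.map (algebraMap K k') F)) = 0

open Literature.AlgebraicGeometry.Resolution in
/-- [OURS · L1 W4.6 (iv)] replaces the role of «the ridge ideal of the typed procedure is characteristic-zero-like for
`p > C(n, d)`» (RESCUE-SEED §1 row W4.6 (iv)) for ONE tangent form, as a statement about Giraud's ridge IDEAL — honest
`C = b`; NOT a statement of the manuscript. **Tame ridge ideal is generated by the linear Hasse derivatives**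
(res-L1-s46-pv-7's proposed item (E) VERBATIM, STATUS 2026-08-27T02:26:44Z; Berthomieu–Hivert–Mourtada Lemma 3.6 /
Algorithm 3.5 in the tame range): in characteristic `p`, over `K`, in `n` variables, for every form `F` of degree `b < p`,
`ridgeIdeal (F) = ⟨D^{(A)} F : |A| + 1 = b⟩` (tree `ridgeIdeal`, `hasseDeriv K A`). CLOSED at every `(p, K, n)` by
`fun _ _ hF hb => CampaignW46.TameRidgeIdeal.ridgeIdeal_span_singleton_eq_span_linearHasse_of_lt_char p hF hb` (p486683).
VACUITY: antecedent satisfiable; at `b = p` the generators of `p`-power degree are needed (BHM Lemma 3.6 proper);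
degenerate-true at `n = 0`. [folklore] -/
def CampaignW46TameRidgeIdealLinear (p : ℕ) [Fact p.Prime] (K : Type u) [Field K] [CharP K p] (n : ℕ) : Prop :=
  ∀ (F : MvPolynomial (Fin n) K) (b : ℕ), F.IsHomogeneous b → b < p →
    ridgeIdeal (Ideal.span {F}) =
      Ideal.span {g | ∃ A : Fin n →₀ ℕ, A.degree + 1 = b ∧ g = hasseDeriv K A F}

open Literature.AlgebraicGeometry.Resolution Literature.AlgebraicGeometry.Hironaka2017.S02Preliminaries IsLocalRing in
/-- [OURS · L1 W4.6 (iv)] replaces the role of «in regime (iv) (`p > C(n, b)`) the invariant `τ` of the typed Th. 16.6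
procedure is computed characteristic-zero-like at every point of every state» (RESCUE-SEED §1 row W4.6 (iv), over the
shared module's `CampaignW46.Regime.charGT` with the HONEST threshold `fun _ b ↦ b`, i.e. `E.b < p`); NOT a statement of
the manuscript. **Regime (iv) makes `τ` first-order** (res-L1-s46-pv-7's proposed item (F) VERBATIM, STATUS
2026-08-27T02:26:44Z): for every state `(A, E)` of the typed procedure (an ambient datum `A` over `K` — a DEFINITION of the
typed §2 vocabulary, nothing asserted — and an ideal exponent `E = (J, b)` on `A.Z`) in the regime
`Regime.charGT n (fun _ b ↦ b)`, every point `ξ` of `Z` whose local ring has characteristic `p` (the typed rows' standing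
binder), every `d` and all `c_1, …, c_d ∈ 𝒪_{Z,ξ}`: `τ_ξ(J_ξ, b) + dim_{κ(ξ)} ⋂_{G ∈ cl_b(J_ξ)} ker(w ↦ Σ_i w_i ∂_i G) = d`
(tree `hironakaTauAt`, `initialForms`, `stalkIdeal`). CLOSED at every `(p, K, n)` by `fun A E hE ξ hp _ c =>
CampaignW46.TameRegime.hironakaTauAt_stalk_add_finrank_iInf_ker_polar A E hE ξ hp c` (p483854). VACUITY: antecedent
`E.b < p` satisfiable (`TameRegime.charGT_order_iff`); the identity is false in general at `b = p` ((G) read in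
`𝒪_{Z,ξ}`); for `d = 0` both summands are `0`. [folklore] -/
def CampaignW46TameRegimeTauFirstOrder (p : ℕ) [Fact p.Prime] (K : Type u) [Field K] [CharP K p] (n : ℕ) : Prop :=
  ∀ (A : AmbientDatum p K) (E : IdealExponent A.Z), CampaignW46.Regime.charGT (p := p) (K := K) n (fun _ b => b) A E →
    ∀ (ξ : A.Z), CharP (A.Z.presheaf.stalk ξ) p → ∀ (d : ℕ) (c : Fin d → A.Z.presheaf.stalk ξ),
      hironakaTauAt c (stalkIdeal E.J ξ) E.b +
        Module.finrank (ResidueField (A.Z.presheaf.stalk ξ))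
          (⨅ G ∈ (initialForms c (stalkIdeal E.J ξ) E.b :
              Set (MvPolynomial (Fin d) (ResidueField (A.Z.presheaf.stalk ξ)))),
            LinearMap.ker (Fintype.linearCombination (ResidueField (A.Z.presheaf.stalk ξ))
              fun i : Fin d => MvPolynomial.pderiv i G) :
                Submodule (ResidueField (A.Z.presheaf.stalk ξ)) (Fin d → ResidueField (A.Z.presheaf.stalk ξ))) = d

open Literature.AlgebraicGeometry.Resolution MvPolynomial in
/-- [OURS · L1 W4.6 (iv)] replaces the role of the HONEST-FAILURE side of «`p > C(n, d)`» (RESCUE-SEED §1 row W4.6 (iv)):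
the threshold of (C)–(F) cannot be lowered — at `deg F = p` the directrix is NOT first-order; NOT a statement of the
manuscript. **Sharpness at the characteristic degree** (res-L1-s46-pv-7's proposed item (G) VERBATIM, STATUS
2026-08-27T02:26:44Z): in characteristic `p`, over `K`, in `d + 1` variables, `τ({Y_0^p}) ≠ dim_K ⟨∂_0 Y_0^p, …, ∂_d Y_0^p⟩`
(left side `1`, right side `0`: every partial of `Y_0^p` vanishes). CLOSED at every `(p, K, d)` by
`CampaignW46.TamePolar.hironakaTau_X_pow_char_ne_finrank_span_pderiv K p` (p481074). VACUITY: a closed computation, true at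
every `d` and every prime `p`; its role is the sharpness certificate for (C)–(F). [folklore] -/
def CampaignW46DirectrixNotFirstOrderAtCharDegree (p : ℕ) [Fact p.Prime] (K : Type u) [Field K] [CharP K p] (d : ℕ) :
    Prop :=
  hironakaTau K ({(X 0 : MvPolynomial (Fin (d + 1)) K) ^ p} : Set (MvPolynomial (Fin (d + 1)) K)) ≠
    Module.finrank K (Submodule.span K (Set.range fun i : Fin (d + 1) =>
      pderiv i ((X 0 : MvPolynomial (Fin (d + 1)) K) ^ p)))

end Summit.ResolutionOfSingularities.ResolutionOfSingularities.Theorems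

end
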